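import Mathlib.Analysis.Matrix.Order
import Mathlib.Analysis.InnerProductSpace.PiL2
import Mathlib.Topology.Algebra.Module.FiniteDimension
import HarnessLib

/-!
# Reduction of a constant-coefficient elliptic operator to the Laplacian (Schauder program, B1)

Topic `Literature/Analysis/FunctionSpaces`. The linear-algebra step of the Schauder theory for
`∑ᵢⱼ aⁱʲ ∂ᵢ∂ⱼ` with constant symmetric coefficients, `λ|ξ|² ≤ aⁱʲξᵢξⱼ ≤ Λ|ξ|²`
(Gilbarg–Trudinger 2001, Lemma 6.1: "by a linear transformation of the independent variables the
equation reduces to Poisson's equation"): on a finite-dimensional real inner product space `E` with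
orthonormal basis `e`, there is a linear automorphism `S` of `E` with

  `∑ₖ ⟪S eₖ, eᵢ⟫ ⟪S eₖ, eⱼ⟫ = aⁱʲ`,  `‖S‖ ≤ √Λ`,  `‖S⁻¹‖ ≤ 1/√λ`,

namely the operator whose matrix is the positive square root of `(aⁱʲ)`; then
`Δ(u ∘ S) = (∑ᵢⱼ aⁱʲ D²u(eᵢ, eⱼ)) ∘ S`, with norms controlled by the ellipticity constants only.

* `exists_equiv_sum_inner_mul_inner_eq` — the statement above.

Census item (2a) of `Literature.Geometry.Riemannian.gurskyViaclovsky_pathOpen_weighted_four`.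
Everything is proved; no named facts.

## References

* D. Gilbarg, N. S. Trudinger, *Elliptic Partial Differential Equations of Second Order* (2001),
  Lemma 6.1, §4.3. [GilbargTrudinger2001]
-/

noncomputable section

open scoped MatrixOrder InnerProductSpace RealInnerProductSpace
open Matrix Finset

namespace Literature.Analysis.FunctionSpaces

variable {ι : Type*} [Fintype ι] [DecidableEq ι] {E : Type*} [NormedAddCommGroup E]
  [InnerProductSpace ℝ E]

omit [DecidableEq ι] in
/-- A real quadratic form written out: `x ⬝ (A x) = ∑ᵢⱼ Aᵢⱼ xᵢ xⱼ`. [folklore] -/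
theorem dotProduct_mulVec_eq_sum_sum (A : Matrix ι ι ℝ) (x : ι → ℝ) :
    x ⬝ᵥ (A *ᵥ x) = ∑ i, ∑ j, A i j * x i * x j := by
  simp only [dotProduct, Matrix.mulVec, Finset.mul_sum]
  exact Finset.sum_congr rfl fun i _ => Finset.sum_congr rfl fun j _ => by ring

/-- **Reduction of constant elliptic coefficients to the Laplacian.** For an orthonormal basis `e`
of `E` and a symmetric matrix `A` with `λ ∑ ξᵢ² ≤ ∑ᵢⱼ Aᵢⱼ ξᵢ ξⱼ ≤ Λ ∑ ξᵢ²` (`0 < λ`), there is a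
linear automorphism `S` of `E` with `∑ₖ ⟪S eₖ, eᵢ⟫ ⟪S eₖ, eⱼ⟫ = Aᵢⱼ`, `‖S‖ ≤ √Λ` and
`‖S⁻¹‖ ≤ (√λ)⁻¹` (the operator with matrix `A^{1/2}` in the basis `e`).
[cite: GilbargTrudinger2001, Lemma 6.1] -/
theorem exists_equiv_sum_inner_mul_inner_eq [FiniteDimensional ℝ E] (bE : OrthonormalBasis ι ℝ E)
    (A : Matrix ι ι ℝ) (hsymm : ∀ i j, A i j = A j i) {l L : ℝ} (hl : 0 < l)
    (hlow : ∀ ξ : ι → ℝ, l * ∑ i, ξ i ^ 2 ≤ ∑ i, ∑ j, A i j * ξ i * ξ j)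
    (hup : ∀ ξ : ι → ℝ, ∑ i, ∑ j, A i j * ξ i * ξ j ≤ L * ∑ i, ξ i ^ 2) :
    ∃ S : E ≃L[ℝ] E, (∀ i j, ∑ k, ⟪S (bE k), bE i⟫ * ⟪S (bE k), bE j⟫ = A i j) ∧
      ‖(S : E →L[ℝ] E)‖ ≤ Real.sqrt L ∧ ‖(S.symm : E →L[ℝ] E)‖ ≤ (Real.sqrt l)⁻¹ := by
  -- the positive square root `Sm` of `A`
  have hAh : A.IsHermitian := Matrix.IsHermitian.ext fun i j => by simpa using hsymm j i
  have hpsd : A.PosSemidef := by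
    refine .of_dotProduct_mulVec_nonneg hAh fun x => ?_
    rw [star_trivial, dotProduct_mulVec_eq_sum_sum]
    exact le_trans (mul_nonneg hl.le (Finset.sum_nonneg fun i _ => sq_nonneg _)) (hlow x)
  have hA0 : (0 : Matrix ι ι ℝ) ≤ A := Matrix.nonneg_iff_posSemidef.2 hpsd
  set Sm : Matrix ι ι ℝ := CFC.sqrt A with hSm
  have hSS : Sm * Sm = A := CFC.sqrt_mul_sqrt_self A hA0
  have hSmh : Sm.IsHermitian := (Matrix.nonneg_iff_posSemidef.1 (CFC.sqrt_nonneg A)).1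
  have hSt : ∀ a b, Sm a b = Sm b a := fun a b => by
    have h := hSmh.apply a b
    rwa [star_trivial, eq_comm] at h
  have hSSij : ∀ i j, ∑ k, Sm i k * Sm j k = A i j := fun i j => by
    rw [← hSS, Matrix.mul_apply]
    exact Finset.sum_congr rfl fun k _ => by rw [hSt j k]
  -- the operator `T` with matrix `Sm` in the basis `bE`
  set T : E →ₗ[ℝ] E := Matrix.toLin bE.toBasis bE.toBasis Sm with hT
  have hrepr_inner : ∀ (x : E) (i : ι), bE.repr x i = ⟪x, bE i⟫ := fun x i => by
    rw [bE.repr_apply_apply, real_inner_comm]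
  have hcoord : ∀ (v : E) (i : ι), bE.repr (T v) i = ∑ k, Sm i k * bE.repr v k := by
    intro v i
    rw [hT, Matrix.toLin_apply, bE.repr_apply_apply, inner_sum]
    simp only [real_inner_smul_right, OrthonormalBasis.coe_toBasis, bE.inner_eq_ite, mul_ite,
      mul_one, mul_zero, Finset.sum_ite_eq, Finset.mem_univ, if_true]
    simp only [Matrix.mulVec, dotProduct, OrthonormalBasis.coe_toBasis_repr_apply]
  have hinner_coord : ∀ x w : E, ⟪x, w⟫ = ∑ i, bE.repr x i * bE.repr w i := fun x w => by
    rw [← bE.sum_inner_mul_inner x w]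
    exact Finset.sum_congr rfl fun i _ => by rw [hrepr_inner, bE.repr_apply_apply]
  have hsa : ∀ v w : E, ⟪T v, w⟫ = ⟪v, T w⟫ := by
    intro v w
    rw [hinner_coord, hinner_coord v (T w)]
    simp only [hcoord, Finset.sum_mul, Finset.mul_sum]
    rw [Finset.sum_comm]
    exact Finset.sum_congr rfl fun i _ => Finset.sum_congr rfl fun k _ => by rw [hSt k i]; ring
  have hq : ∀ v : E, ‖T v‖ ^ 2 = ∑ i, ∑ j, A i j * bE.repr v i * bE.repr v j := by
    intro v
    rw [← real_inner_self_eq_norm_sq, hsa, hinner_coord]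
    refine Finset.sum_congr rfl fun i _ => ?_
    have hTT : bE.repr (T (T v)) i = ∑ j, A i j * bE.repr v j := by
      rw [hcoord]
      simp only [hcoord, Finset.mul_sum]
      rw [Finset.sum_comm]
      refine Finset.sum_congr rfl fun j _ => ?_
      rw [← hSSij i j, Finset.sum_mul]
      exact Finset.sum_congr rfl fun k _ => by rw [hSt j k]; ring
    rw [hTT, Finset.mul_sum]
    exact Finset.sum_congr rfl fun j _ => by ring
  have hnorm : ∀ v : E, ‖v‖ ^ 2 = ∑ i, bE.repr v i ^ 2 := fun v => by
    rw [← bE.repr.norm_map v, EuclideanSpace.norm_eq, Real.sq_sqrt (Finset.sum_nonneg fun i _ => by positivity)]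
    exact Finset.sum_congr rfl fun i _ => by rw [Real.norm_eq_abs, sq_abs]
  have hup' : ∀ v : E, ‖T v‖ ^ 2 ≤ L * ‖v‖ ^ 2 := fun v => by rw [hq, hnorm]; exact hup _
  have hlow' : ∀ v : E, l * ‖v‖ ^ 2 ≤ ‖T v‖ ^ 2 := fun v => by rw [hq, hnorm]; exact hlow _
  -- `T` is invertible
  have hinj : Function.Injective T := by
    intro v w hvw
    rw [← sub_eq_zero] at hvw ⊢
    rw [← map_sub] at hvw
    have h := hlow' (v - w)
    rw [hvw, norm_zero] at h
    have h2 : ‖v - w‖ ^ 2 ≤ 0 := le_of_mul_le_mul_left (by simpa using h) hl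
    have h3 : ‖v - w‖ ^ 2 = 0 := le_antisymm h2 (sq_nonneg _)
    rwa [sq_eq_zero_iff, norm_eq_zero] at h3
  set Se : E ≃ₗ[ℝ] E := LinearEquiv.ofBijective T ⟨hinj, LinearMap.injective_iff_surjective.1 hinj⟩
    with hSe
  have hSe_apply : ∀ v, Se v = T v := fun v => rfl
  refine ⟨Se.toContinuousLinearEquiv, fun i j => ?_, ?_, ?_⟩
  · -- the entries of `S` are those of `Sm`
    have hent : ∀ k i, ⟪Se.toContinuousLinearEquiv (bE k), bE i⟫ = Sm i k := fun k i => by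
      rw [LinearEquiv.coe_toContinuousLinearEquiv', hSe_apply, ← hrepr_inner, hcoord]
      simp [bE.repr_self]
    simp only [hent]
    exact hSSij i j
  · refine ContinuousLinearMap.opNorm_le_bound _ (Real.sqrt_nonneg _) fun v => ?_
    rw [ContinuousLinearEquiv.coe_coe, LinearEquiv.coe_toContinuousLinearEquiv', hSe_apply]
    calc ‖T v‖ = Real.sqrt (‖T v‖ ^ 2) := (Real.sqrt_sq (norm_nonneg _)).symm
      _ ≤ Real.sqrt (L * ‖v‖ ^ 2) := Real.sqrt_le_sqrt (hup' v)
      _ = Real.sqrt L * ‖v‖ := by rw [Real.sqrt_mul' _ (sq_nonneg _), Real.sqrt_sq (norm_nonneg _)]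
  · refine ContinuousLinearMap.opNorm_le_bound _ (inv_nonneg.2 (Real.sqrt_nonneg _)) fun w => ?_
    rw [ContinuousLinearEquiv.coe_coe]
    set v := Se.toContinuousLinearEquiv.symm w with hv
    have hTv : T v = w := by
      rw [← hSe_apply, hv, LinearEquiv.coe_toContinuousLinearEquiv_symm', LinearEquiv.apply_symm_apply]
    have h1 : l * ‖v‖ ^ 2 ≤ ‖w‖ ^ 2 := hTv ▸ hlow' v
    have h2 : ‖v‖ ^ 2 ≤ ‖w‖ ^ 2 / l := by rw [le_div_iff₀ hl]; linarith
    calc ‖v‖ = Real.sqrt (‖v‖ ^ 2) := (Real.sqrt_sq (norm_nonneg _)).symm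
      _ ≤ Real.sqrt (‖w‖ ^ 2 / l) := Real.sqrt_le_sqrt h2
      _ = (Real.sqrt l)⁻¹ * ‖w‖ := by
          rw [Real.sqrt_div (sq_nonneg _), Real.sqrt_sq (norm_nonneg _), div_eq_inv_mul]

end Literature.Analysis.FunctionSpaces

end
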